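import Summits.AtomisticToContinuum.Crystallization.Theses.SymmetryRankLadder
import Summits.AtomisticToContinuum.Crystallization.Theorems.PricedLinkCensusStackingHingeHcpEnergyMinOnBox

/-!
# Crux workfile — `HcpPeriodicMinimiser` (stmt-AtomisticToContinuum-3061): the PROVED assembly of its
typed decomposition in route `SymmetryRankLadder` (BC2 redirect, crux-strategist 2026-08-17)

This is the kernel-checked assembly theorem of the route-level split
`HcpPeriodicMinimiser ⟸ TransverseCompactness ∧ TriangularLayering ∧ MonolayerStackOptimality
(∧ HcpEnergyMinOnBox, proved)`.  `Theorems/` is prover-only, so the identical file (namespace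
`…Theorems.SymmetryRankLadderHcpPeriodicMinimiserSplit`, attached as evidence `Split.lean` on items
3061 and 5834) is to be landed verbatim by any prover as
`Summits/AtomisticToContinuum/Crystallization/Theorems/SymmetryRankLadderHcpPeriodicMinimiserSplit.lean`
(`--workitem stmt-AtomisticToContinuum-5834`, it closes `RungTwoGlue`; rc 0, 0 sorries, standard axioms).

## The decomposition

`HcpPeriodicMinimiser` (some relaxed hcp `hcpPeriodicConfiguration a h`, `(a, h)` in the box
`B = [47/50, 1] × [39a/50, 17a/20]`, is a least element of the Lennard-Jones energy per particle
over ALL periodic configurations of `ℝ³`) is the conjunction-free composite of four typed pieces of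
three different dimensions, each filed as an item of the route:

* `TransverseCompactness` (stmt-5831, 3-D): every periodic `Q` is matched, at no higher energy per
  particle, by a periodic `Q₁` with hard core `1/2` and two linearly independent periods of length
  `≤ 6/5`;
* `TriangularLayering` (stmt-5832, 2-D): every such `Q₁` is matched by a periodic monolayer
  triangular stack `Q₂` (`A₂(a)`-layers, `a ∈ [47/50, 1]`, free offsets, gaps in `[7/10, 1]`);
* `MonolayerStackOptimality` (stmt-5833, 1-D): every such stack is beaten by some relaxed hcp with
  parameters in `B`;
* `HcpEnergyMinOnBox` (stmt-3066, 0-D / compactness): `(a, h) ↦ e_LJ(hcp a h)` attains its minimum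
  on `B` — already proved in tree for the verbatim-shared `PoissonBesselStacking.HcpEnergyMinOnBox`
  (`PricedHcpWindowsHcpBox.stub_hcpEnergyMinOnBox`), re-exported here by definitional unfolding.

`hcpPeriodicMinimiser_of_subs` is the assembly `X₁ → X₂ → X₃ → X₄ → HcpPeriodicMinimiser`
(= the route's support item `RungTwoGlue`, stmt-5834, proved here as `rungTwoGlue_proof`): for an
arbitrary periodic competitor `Q` the three matchings are CHAINED — the output class of each piece
is the input class of the next — `e(Q) ≥ e(Q₁) ≥ e(Q₂) ≥ e(hcp a' h) ≥ e(hcp a₀ h₀)`, the last step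
by the box minimum, and `hcp a₀ h₀` is itself a periodic configuration, whence `IsLeast`.
`hcpPeriodicMinimiser_of_cruxes` discharges the fourth (proved) piece, leaving the three cruxes.
All `[folklore]` (pure composition); no definitions are introduced.
-/

namespace Summit.AtomisticToContinuum.Crystallization.Cruxes.HcpPeriodicMinimiser.SplitAssembly

open Literature.MathematicalPhysics.StatisticalMechanics
open Summit.AtomisticToContinuum.Crystallization.Theses.SymmetryRankLadder

/-- **Assembly of the rung-2 decomposition** (`RungTwoGlue`, stmt-AtomisticToContinuum-5834):
`TransverseCompactness → TriangularLayering → MonolayerStackOptimality → HcpEnergyMinOnBox →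
HcpPeriodicMinimiser`.  The witness is the box minimiser `(a₀, h₀)` of the fourth piece; for a
competitor `Q` chain the three matchings and the box minimum. [folklore] -/
theorem hcpPeriodicMinimiser_of_subs :
    TransverseCompactness → TriangularLayering → MonolayerStackOptimality → HcpEnergyMinOnBox →
      HcpPeriodicMinimiser := by
  intro hC2 hL2 hS2 hBox
  -- the witness: the minimiser of the relaxed hcp energy on the box `B`
  obtain ⟨a₀, h₀, ha₀, hh₀, hB₁, hB₂, hB₃, hB₄, hmin⟩ := hBox
  refine ⟨a₀, h₀, ha₀, hh₀, hB₁, hB₂, hB₃, hB₄, Set.mem_range_self _, ?_⟩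
  -- lower bound against an arbitrary periodic competitor `Q`
  rintro _ ⟨Q, rfl⟩
  -- (C2) transverse compactness: hard core `1/2` and two periods of length `≤ 6/5`
  obtain ⟨Q₁, hQ₁, hcore, hper⟩ := hC2 Q
  -- (L2) triangular layering of the short-period hard-core competitor
  obtain ⟨Q₂, hQ₂, a, ha₁, ha₂, hu, hv, hlayer, hgap, hnext⟩ := hL2 Q₁ hcore hper
  -- (S2′) the monolayer triangular stack is beaten by a relaxed hcp of the box
  obtain ⟨a', h, ha', hh, hb₁, hb₂, hb₃, hb₄, hhcp⟩ :=
    hS2 Q₂ a ha₁ ha₂ ⟨hu, hv, hlayer, hgap, hnext⟩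
  -- (box) the box minimiser beats every relaxed hcp of the box
  calc (hcpPeriodicConfiguration ha₀ hh₀).energyPerParticle lennardJones
      ≤ (hcpPeriodicConfiguration ha' hh).energyPerParticle lennardJones :=
        hmin a' h ha' hh hb₁ hb₂ hb₃ hb₄
    _ ≤ Q₂.energyPerParticle lennardJones := hhcp
    _ ≤ Q₁.energyPerParticle lennardJones := hQ₂
    _ ≤ Q.energyPerParticle lennardJones := hQ₁

/-- **Item stmt-AtomisticToContinuum-5834** (`RungTwoGlue`) is exactly the assembly above.
[folklore] -/
theorem rungTwoGlue_proof : RungTwoGlue := hcpPeriodicMinimiser_of_subs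

/-- **Item stmt-AtomisticToContinuum-3066** (`HcpEnergyMinOnBox`) for this route: the statement is
shared verbatim with `PoissonBesselStacking.HcpEnergyMinOnBox`, proved in tree by
`PricedHcpWindowsHcpBox.stub_hcpEnergyMinOnBox`; the two `def`s unfold to the same proposition.
[folklore] -/
theorem hcpEnergyMinOnBox_proof : HcpEnergyMinOnBox :=
  Summit.AtomisticToContinuum.Crystallization.Theorems.PricedHcpWindowsHcpBox.stub_hcpEnergyMinOnBox

/-- **The three cruxes suffice**: `TransverseCompactness → TriangularLayering →
MonolayerStackOptimality → HcpPeriodicMinimiser`, the compactness piece being a theorem.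
[folklore] -/
theorem hcpPeriodicMinimiser_of_cruxes :
    TransverseCompactness → TriangularLayering → MonolayerStackOptimality → HcpPeriodicMinimiser :=
  fun hC2 hL2 hS2 => hcpPeriodicMinimiser_of_subs hC2 hL2 hS2 hcpEnergyMinOnBox_proof

end Summit.AtomisticToContinuum.Crystallization.Cruxes.HcpPeriodicMinimiser.SplitAssembly
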